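import Summits.AtomisticToContinuum.Crystallization.Theorems.OverbindingBudgetStackedRigidityUniq
import Summits.AtomisticToContinuum.Crystallization.Theorems.OverbindingBudgetBalancedReferenceKernel

/-!
# OverbindingBudget · decomp-a2c lens-4 g32 — part XX: the REGISTRY CUT of slot 7d (consumer cut of `BasalReferenceW`, critic row 460 (A))

Helper file under `--supports stmt-AtomisticToContinuum-31280` (RDEF = `Theses.OverbindingBudget.RobustDefectLimitWindows`); closes nothing.
Slot 7d of the cone of record (`rdef_of_grossU_shape_gluing_pinning_uniqW`, part XIX-U) is the EXISTENCE statement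
`BasalReferenceW Λ₁ ρ₁`: next to every admissible configuration (stacked, `δ`-separated, clean-W, single-site Nash, stress-free, zero transmitted
stress across every gap, independent in-plane periods of norm `≤ Λ₁`) there is a stacked zero-gap-stress UNIFORMLY CLEAN reference whose increments
are within `ρ₁` of the configuration's.  Part XIX-K landed the abstract existence kernel `exists_zeroStress_of_tube_data` (a zero of the gap-stress
map inside scalar-monotone windows `closedBall (c k) r` round ANY centre profile `c` with residual `≤ ε`, provided `4ε ≤ 3(λ − ρ)r`).  This file
chooses the centre and cuts 7d into pieces each strictly smaller than 7d, with the seam PROVED: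

**The centre is EXPLICIT and configuration-free** (an existential centre is costume: `c := incr w`, `ε := 0` returns the parent): the TWO-VALUED
BALANCED REGISTRY PROFILE `reg a b n c σ u v m = (if σ m then c else rotPi n c) + u m • a + v m • b` — `c` a BALANCED increment of the in-plane cell
(`unifStress a b c = 0`: the uniform stack with increment `c` transmits no stress, i.e. `c` is a critical point of the uniform-stack cell energy; height
`⟪c, n⟫ ≥ 1/2`; lateral part within `1/10` of the hollow `hol a b`), `rotPi n c` its image under the half-turn about the unit normal `n` (the other
hollow coset, same height), `σ : ℤ → Bool` the coset sequence (every `σ` is a Barlow stacking), `u v : ℤ → ℤ` lattice drifts of the increments.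
Two structural gains over a configuration-centred kernel: (1) the residual at a balanced two-valued profile is the span-`≥ 2` REGISTRY MODULATION
only (nearest-layer terms vanish identically by balance and the half-turn symmetry; no lattice pinning enters the residual); (2) the kernel's window
radius `r` DECOUPLES from the localisation radius `r′` (the slack goes into `ρ₁`), so tube data are needed only on `r`-balls round the exact registry
with `r` as small as the residual allows (`r ≥ 4ε/(3μ)`).  CURRENCY (TAG 161b (i)/(iv)): the kernel's `λ` is the single-site monotonicity modulus
of `gapStress m` in its own increment over the `r`-ball (`≈ λ₁(r) ≈ 2.6` at the stress-free spacing `b = a⋆ ≈ 0.9713`, hcp = fcc to 3 digits) and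
`ρd ≥ Σ_{j≠0} κ_j` the ℓ¹ coupling (`Σκ = 32.48`, `κ₀ = 31.15` ⇒ `1.33` at `1/40`) ⇒ margin `λ − ρd ≈ 1.27`; this is NOT the cruder scalar seam
`λ₁ − Σ s²τ_s ≈ +0.24`.  On the PINNED box (R4: `b ≈ a⋆ ± 0.5 %`, the only spacings `StressFree` admits — critic rows 463/466) both are alive;
the `b ≤ 0.92` failures of the seam lie outside the box.  Of record (provisional, census TAG requested): `(ε, r, μ; r′, r″) =
(1/250, 1/100, 1; 7/40, 3/500)` at `(Λ, Λ₁; ρ₀, ρ₁) = (2, 17/16; 1/40, 3/16)`, box `[s₁, s₂] ≈ [0.966, 0.976]` to be fixed by the census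
(`4ε = 0.016 ≤ 3μr″ = 0.018 ≤ 3μr`, `r′ + r″ ≤ ρ₁`; feasibility band `ε_mod ≤ 3·margin·r″_max/4 ≈ 7·10⁻³`, `r″_max ≈ 1/125` from R5).

## The pieces (Props; tags = lens-4's reading, numbers provisional pending census)

* R4 `CellPinningW Λ₁ s₁ s₂` — an admissible configuration has its in-plane cell PINNED: `a`, `b` and the third side of the nearest-neighbour
  triangle have norms in `[s₁, s₂]` (zero in-plane stress + zero gap stress put the cell at the zero-stress Barlow cell, nn distance
  `(A₁₂/A₆)^{1/6} ≈ 0.9712` for `V = r⁻¹²/12 − r⁻⁶/6`). [ANALYTIC·M (virial ⇒ lattice-sum pressure identity; monotonicity of the pressure in the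
  scale over the clean box, CERT)]  Not implied by 7d (7d pins the cell only to the floating `2 %` box of `UniformlyClean`); TRUE-type.
* R3 `RegistryLocalisationW Λ₁ s₁ s₂ r′` — an admissible configuration over a pinned cell has a unit normal `n`, a balanced increment `c`, cosets
  `σ` and drifts `u v` with `‖incr w m − reg a b n c σ u v m‖ ≤ r′` for every `m`. [GEOMETRY·S/M: clean-W stacked layers are hollow-registered to
  `≈ a/16`; existence + location of the balanced increment over the pinned box by minimisation]
* R1 `RegistryResidual s₁ s₂ ε` — at every two-valued balanced registry profile over a pinned cell every gap stress has norm `≤ ε`.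
  [CERT·S: span-`≥ 2` registry modulation; expected `≈ 2–3·10⁻³` = (balanced-height spread `≤ 2.2·10⁻⁴ b` across Barlow words, TAG 161b (iii) /
  B164) × (gap stiffness `10–20`); of record `ε = 4·10⁻³`]
* R2 `RegistryTube s₁ s₂ r μ` — scalar tube data (`λ`-monotone in the own increment, `ℓ¹`-Lipschitz across gaps with weights `κ`,
  `Σκ − κ₀ ≤ ρd`, margin `ρd + μ ≤ λ`) on the windows `closedBall (reg … k) r`, in the kernel's exact form. [CERT·M: kernel currency
  `λ₁(r) − Σ_{j≠0} κ_j ≈ 2.6 − 1.33` at `b = a⋆` (TAG 161b (i)); of record `(r, μ) = (1/100, 1)`]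
* R5 `RegistryMetric s₁ s₂ r″` — every offset profile whose increments are within `r″` of a two-valued balanced registry profile over a pinned cell
  generates a UNIFORMLY CLEAN layered set. [PATTERN·S: twelve neighbours within `2 %` of `a′ ≈ 0.971`, second distances `≥ √2·0.97 > 1.26 a′`]
* interfaces (configuration-free core of slot 7): Z∃ `RegistryZeroExists s₁ s₂ r″` (every Barlow coset sequence over a pinned cell carries a
  zero-gap-stress increment profile within `r″` of its balanced registry profile — equilibrium polytypes exist) and Z! `RegistryZeroUnique s₁ s₂ r`
  (two zero-gap-stress profiles within `r` of the same registry profile coincide).  FEEDERS PROVED here from the scalar data: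
  `zeroExists_of_residual_tube : R1 ε → R2 r μ → (4ε ≤ 3μr, 4ε ≤ 3μr″) → Z∃ r″`, `zeroUnique_of_tube : R2 r μ → Z! r`; convex data (lens-3's
  `IsTubeConvex` round the registry + its Browder–Minty twin) can feed the same two names.

## Seams (PROVED) and cones

* EIGHTEENTH `basalReferenceW_of_registry : R4 → R3 r′ → Z∃ r″ → R5 r″ → (r″ < 1/2) → (r′ + r″ ≤ ρ₁) → BasalReferenceW Λ₁ ρ₁`, and ★ the cone
  `rdef_of_grossU_shape_gluing_pinning_uniq_registry` (the sixteenth-uniq cone with slot 7d so cut; scalar-fed form `…_registryScalar`).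
* NINETEENTH `basalGapRigidityW_of_registry : R4 → R3 r′ → Z∃ r″ → Z! r → R5 r″ → (r″ ≤ r) → (r′ ≤ r) → BasalGapRigidityW Λ₁` — when the tube data
  round the REGISTRY are fat (`r ≥ r′`, convex typing) slots 7c `TubeUniquenessW` and 7c″ `RegistryPinningW` are not needed at all; cone
  `rdef_of_grossU_shape_gluing_registry`.
-/

noncomputable section

namespace Summit.AtomisticToContinuum.Crystallization.Theorems.OverbindingBudgetRegistryCut

open Metric
open scoped RealInnerProductSpace
open Summit.AtomisticToContinuum.Crystallization.Theses.OverbindingBudget (RobustDefectLimitWindows)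
open Summit.AtomisticToContinuum.Crystallization.Theses.PricedLinkCensus (ChargedEnergyGap)
open Summit.AtomisticToContinuum.Crystallization.Theorems.OverbindingBudgetGradedBareness (CleanlessExcessT)
open Summit.AtomisticToContinuum.Crystallization.Theorems.OverbindingBudgetCoherentCut (CoherentResidual)
open Summit.AtomisticToContinuum.Crystallization.Theorems.OverbindingBudgetUniformCutStatements (GrossCleanBallsU)
open Summit.AtomisticToContinuum.Crystallization.Theorems.OverbindingBudgetElasticSplitScale (CompressedVirialLaw)
open Summit.AtomisticToContinuum.Crystallization.Theorems.OverbindingBudgetElasticSplitShear (StressFree)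
open Summit.AtomisticToContinuum.Crystallization.Theorems.ChartedPlanarOrderChunkFloor (E3)
open Summit.AtomisticToContinuum.Crystallization.Theorems.ChartedPlanarOrderRigidityDoor (IsNash)
open Summit.AtomisticToContinuum.Crystallization.Theorems.ChartedPlanarOrderDensityDichotomy (μS IsSep)
open Summit.AtomisticToContinuum.Crystallization.Theorems.ChartedPlanarOrderDoorLayered (Layered)
open Summit.AtomisticToContinuum.Crystallization.Theorems.ChartedPlanarOrderProfileSlavingLJ (IsStacked gapStress incr tube)
open Summit.AtomisticToContinuum.Crystallization.Theorems.OverbindingBudgetPeriodicCleanOrStrained (UniformlyClean)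
open Summit.AtomisticToContinuum.Crystallization.Theorems.OverbindingBudgetScaleWidening (IsCleanW DoorPeriodicW)
open Summit.AtomisticToContinuum.Crystallization.Theorems.OverbindingBudgetTwoShellShape (TwoShellShape BarlowGluingW)
open Summit.AtomisticToContinuum.Crystallization.Theorems.OverbindingBudgetStackedRigidityW (StackedReductionW GapStressVanishesW
  BasalGapRigidityW BasalReferenceW rdef_of_grossU_shape_gluing_stackedW)
open Summit.AtomisticToContinuum.Crystallization.Theorems.OverbindingBudgetStackedRigidityRef (RegistryPinningW)
open Summit.AtomisticToContinuum.Crystallization.Theorems.OverbindingBudgetStackedRigidityUniq (TubeUniquenessW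
  rdef_of_grossU_shape_gluing_pinning_uniqW)
open Summit.AtomisticToContinuum.Crystallization.Theorems.OverbindingBudgetBalancedReferenceKernel (exists_zeroStress_of_tube_data
  zero_unique_of_tube_data)

/-! ## §1 The explicit registry vocabulary (local to lens-4; no definition shared with lens-3's (m)(n)) -/

/-- the half-turn about the axis `n` (for a unit vector `n`): lateral part negated, `n`-component kept. -/
def rotPi (n c : E3) : E3 := (2 * ⟪c, n⟫) • n - c

/-- one hollow (deep-hole) representative of the near-triangular in-plane cell `(a, b)`: the centroid of the nearest-neighbour triangle `(0, a, b)`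
(angle `60°`, `⟪a, b⟫ ≥ 0`) resp. `(0, a, −b)` (angle `120°`). -/
def hol (a b : E3) : E3 := if 0 ≤ ⟪a, b⟫ then (1 / 3 : ℝ) • (a + b) else (1 / 3 : ℝ) • (a - b)

/-- the stress transmitted across a gap of the UNIFORM stack with increment `c`: `Σ_{s ≥ 1} s · layerForce a b (−s c)` (the gap-stress map at the
constant increment profile; `= ∇` of the uniform-stack cell energy). -/
def unifStress (a b c : E3) : E3 := gapStress a b 0 (fun _ => c)

/-- `n` is a unit normal of the in-plane cell. -/
def IsUnitNormal (a b n : E3) : Prop := ‖n‖ = 1 ∧ ⟪n, a⟫ = 0 ∧ ⟪n, b⟫ = 0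

/-- **balanced increment**: height `≥ 1/2` along `n`, lateral part within `1/10` of the hollow `hol a b`, and the uniform stack with increment `c`
transmits NO stress (excludes the bridge / on-top critical points). -/
def IsBalanced (a b n c : E3) : Prop := 1 / 2 ≤ ⟪c, n⟫ ∧ ‖c - (hol a b + ⟪c, n⟫ • n)‖ ≤ 1 / 10 ∧ unifStress a b c = 0

/-- **the two-valued balanced registry profile** with coset sequence `σ` and lattice drifts `u, v`. -/
def reg (a b n c : E3) (σ : ℤ → Bool) (u v : ℤ → ℤ) (m : ℤ) : E3 :=
  (if σ m then c else rotPi n c) + (((u m : ℤ) : ℝ) • a + ((v m : ℤ) : ℝ) • b)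

/-- **pinned cell**: `a`, `b` and the third side of the nearest-neighbour triangle have norms in `[s₁, s₂]`. -/
def Pinned (s₁ s₂ : ℝ) (a b : E3) : Prop :=
  s₁ ≤ ‖a‖ ∧ ‖a‖ ≤ s₂ ∧ s₁ ≤ ‖b‖ ∧ ‖b‖ ≤ s₂ ∧ ((s₁ ≤ ‖a - b‖ ∧ ‖a - b‖ ≤ s₂) ∨ (s₁ ≤ ‖a + b‖ ∧ ‖a + b‖ ≤ s₂))

/-! ## §2 The pieces -/

/-- **R4 · `CellPinningW Λ₁ s₁ s₂`** — an admissible configuration (7d's hypotheses verbatim) has a pinned in-plane cell.  Why it might fail: only if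
the box `[s₁, s₂]` is set tighter than the spread of the zero-stress nn distance over Barlow sequences (`≈ 10⁻⁴` relative) plus nothing — zero
in-plane virial and zero gap stress are equalities. [ANALYTIC·M + CERT] [piece] -/
def CellPinningW (Λ₁ s₁ s₂ : ℝ) : Prop :=
  ∀ δ : ℝ, 0 < δ → ∀ (a b : E3) (w : ℤ → E3), IsStacked a b w → LinearIndependent ℝ ![a, b] →
    ‖a‖ ≤ Λ₁ → ‖b‖ ≤ Λ₁ → IsSep δ (Layered a b w) → IsCleanW (μS (Layered a b w)) → IsNash (μS (Layered a b w)) →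
    StressFree (Layered a b w) → (∀ m : ℤ, gapStress a b m (incr w) = 0) → Pinned s₁ s₂ a b

/-- **R3 · `RegistryLocalisationW Λ₁ s₁ s₂ r′`** — an admissible configuration over a pinned cell is within `r′`, increment by increment, of a
two-valued balanced registry profile.  Why it might fail: `r′` below the clean-W registry tolerance (`≈ 0.07` lateral; heights need the zero normal
gap stress) — of record `r′ = 7/40`. [GEOMETRY·S/M] [piece] -/
def RegistryLocalisationW (Λ₁ s₁ s₂ r' : ℝ) : Prop :=
  ∀ δ : ℝ, 0 < δ → ∀ (a b : E3) (w : ℤ → E3), IsStacked a b w → LinearIndependent ℝ ![a, b] →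
    ‖a‖ ≤ Λ₁ → ‖b‖ ≤ Λ₁ → IsSep δ (Layered a b w) → IsCleanW (μS (Layered a b w)) → IsNash (μS (Layered a b w)) →
    StressFree (Layered a b w) → (∀ m : ℤ, gapStress a b m (incr w) = 0) → Pinned s₁ s₂ a b →
    ∃ (n c : E3) (σ : ℤ → Bool) (u v : ℤ → ℤ), IsUnitNormal a b n ∧ IsBalanced a b n c ∧
      ∀ m : ℤ, ‖incr w m - reg a b n c σ u v m‖ ≤ r'

/-- **R1 · `RegistryResidual s₁ s₂ ε`** — the gap stresses of a two-valued balanced registry profile over a pinned cell have norm `≤ ε`.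
Why it might fail: `ε` below the span-`≥ 2` registry modulation of the layer force at heights `≥ 2γ ≈ 1.59` (expected `≈ 2–3·10⁻³`: balanced-height
spread `≤ 2.2·10⁻⁴ b` across Barlow words (TAG 161b (iii), B164) times gap stiffness `10–20`; of record `ε = 4·10⁻³`).
[CERT·S] [piece] -/
def RegistryResidual (s₁ s₂ ε : ℝ) : Prop :=
  ∀ (a b n c : E3) (σ : ℤ → Bool) (u v : ℤ → ℤ), Pinned s₁ s₂ a b → IsUnitNormal a b n → IsBalanced a b n c →
    ∀ m : ℤ, ‖gapStress a b m (reg a b n c σ u v)‖ ≤ ε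

/-- **R2 · `RegistryTube s₁ s₂ r μ`** — scalar tube data on the `r`-windows round a two-valued balanced registry profile over a pinned cell, with
dominance margin `μ` (`Σκ − κ₀ ≤ ρd`, `ρd + μ ≤ λ`), in the exact form the kernel `exists_zeroStress_of_tube_data` consumes.  Why it might fail:
`μ` above the kernel-currency margin `λ₁(r) − Σ_{j≠0} κ_j` round the registry (`≈ 2.6 − 1.33 = 1.27` at `r = 1/40`, `b = a⋆`, TAG 161b (i);
mixed words and the `± 0.5 %` box may shave it); of record `(r, μ) = (1/100, 1)`. [CERT·M] [piece] -/
def RegistryTube (s₁ s₂ r μ : ℝ) : Prop :=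
  ∀ (a b n c : E3) (σ : ℤ → Bool) (u v : ℤ → ℤ), Pinned s₁ s₂ a b → IsUnitNormal a b n → IsBalanced a b n c →
    ∃ (lam ρd : ℝ) (κ : ℤ → ℝ), (∀ j, 0 ≤ κ j) ∧ Summable κ ∧ (∑' j, κ j) - κ 0 ≤ ρd ∧ ρd + μ ≤ lam ∧
      (∀ m : ℤ, ∀ h : ℤ → E3, (∀ k, h k ∈ closedBall (reg a b n c σ u v k) r) → ∀ b' ∈ closedBall (reg a b n c σ u v m) r,
        lam * ‖h m - b'‖ ^ 2 ≤ ⟪gapStress a b m h - gapStress a b m (Function.update h m b'), h m - b'⟫) ∧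
      (∀ m : ℤ, ∀ h h' : ℤ → E3, (∀ k, h k ∈ closedBall (reg a b n c σ u v k) r) → (∀ k, h' k ∈ closedBall (reg a b n c σ u v k) r) →
        ‖gapStress a b m h - gapStress a b m h'‖ ≤ ∑' j : ℤ, κ j * ‖h (m + j) - h' (m + j)‖)

/-- **R5 · `RegistryMetric s₁ s₂ r″`** — an offset profile whose increments are within `r″` of a two-valued balanced registry profile over a pinned
cell generates a uniformly clean layered set.  Why it might fail: `r″ + (s₂ − s₁)` eating the `2 %` tolerance of `UniformlyClean`: the twelve
bonds lie in `[0.960 − r″, 0.982 + r″]` (in-plane `[s₁, s₂]`, interlayer `±` cell anisotropy, `|∂ bond/∂ incr| = 1`) vs `[0.98a′, 1.02a′]` at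
`a′ = 0.971` ⇒ `r″ ≤ 1/125`; of record `r″ = 3/500`, box width `1 %`. [PATTERN·S] [piece] -/
def RegistryMetric (s₁ s₂ r'' : ℝ) : Prop :=
  ∀ (a b n c : E3) (σ : ℤ → Bool) (u v : ℤ → ℤ), Pinned s₁ s₂ a b → IsUnitNormal a b n → IsBalanced a b n c →
    ∀ w' : ℤ → E3, (∀ k : ℤ, ‖incr w' k - reg a b n c σ u v k‖ ≤ r'') → UniformlyClean (Layered a b w')

/-- **Z∃ · `RegistryZeroExists s₁ s₂ r″`** (interface) — every coset sequence over a pinned cell carries a zero-gap-stress increment profile within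
`r″` of its two-valued balanced registry profile (equilibrium polytypes exist).  Fed by R1 + R2 (`zeroExists_of_residual_tube`, PROVED) or by convex
data. [ANALYTIC ✓ + CERT] [piece] -/
def RegistryZeroExists (s₁ s₂ r'' : ℝ) : Prop :=
  ∀ (a b n c : E3) (σ : ℤ → Bool) (u v : ℤ → ℤ), Pinned s₁ s₂ a b → IsUnitNormal a b n → IsBalanced a b n c →
    ∃ h : ℤ → E3, (∀ k : ℤ, ‖h k - reg a b n c σ u v k‖ ≤ r'') ∧ ∀ m : ℤ, gapStress a b m h = 0

/-- **Z! · `RegistryZeroUnique s₁ s₂ r`** (interface) — two zero-gap-stress increment profiles within `r` of the same two-valued balanced registry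
profile over a pinned cell coincide.  Fed by R2 (`zeroUnique_of_tube`, PROVED) or by convex data round the registry. [CERT] [piece] -/
def RegistryZeroUnique (s₁ s₂ r : ℝ) : Prop :=
  ∀ (a b n c : E3) (σ : ℤ → Bool) (u v : ℤ → ℤ), Pinned s₁ s₂ a b → IsUnitNormal a b n → IsBalanced a b n c →
    ∀ h h' : ℤ → E3, (∀ k : ℤ, ‖h k - reg a b n c σ u v k‖ ≤ r) → (∀ k : ℤ, ‖h' k - reg a b n c σ u v k‖ ≤ r) →
      (∀ m : ℤ, gapStress a b m h = 0) → (∀ m : ℤ, gapStress a b m h' = 0) → h = h'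

/-! ## §3 Lemmas: the normal component of the registry profile; stackedness inside the windows; offset profiles with given increments -/

/-- `⟪n, rotPi n c⟫ = ⟪c, n⟫` for a unit `n`. [folklore] -/
theorem inner_rotPi {n : E3} (hn : ‖n‖ = 1) (c : E3) : ⟪n, rotPi n c⟫ = ⟪c, n⟫ := by
  unfold rotPi
  rw [inner_sub_right, inner_smul_right, real_inner_self_eq_norm_sq, hn, real_inner_comm n c]
  ring

/-- every value of the registry profile has `n`-component `⟪c, n⟫`. [this file] -/
theorem inner_reg {a b n c : E3} (hn : IsUnitNormal a b n) (σ : ℤ → Bool) (u v : ℤ → ℤ) (m : ℤ) :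
    ⟪n, reg a b n c σ u v m⟫ = ⟪c, n⟫ := by
  obtain ⟨h1, ha, hb⟩ := hn
  unfold reg
  rw [inner_add_right, inner_add_right, inner_smul_right, inner_smul_right, ha, hb, mul_zero, mul_zero, add_zero, add_zero]
  split_ifs
  · exact real_inner_comm _ _
  · exact inner_rotPi h1 c

/-- `⟪n, x⟫ ≥ ⟪n, y⟫ − t` whenever `‖x − y‖ ≤ t` and `‖n‖ = 1`. [folklore] -/
theorem inner_ge_of_near {n x y : E3} (hn : ‖n‖ = 1) {t : ℝ} (h : ‖x - y‖ ≤ t) : ⟪n, y⟫ - t ≤ ⟪n, x⟫ := by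
  have h1 : |⟪n, x - y⟫| ≤ ‖n‖ * ‖x - y‖ := abs_real_inner_le_norm n (x - y)
  rw [hn, one_mul, inner_sub_right] at h1
  have h2 := neg_le_of_abs_le h1
  linarith

/-- an offset profile whose increments are within `t < 1/2` of a registry profile (heights `≥ 1/2`) is stacked along `n`. [this file] -/
theorem isStacked_of_near_reg {a b n c : E3} {σ : ℤ → Bool} {u v : ℤ → ℤ} {w' : ℤ → E3} {t : ℝ}
    (hn : IsUnitNormal a b n) (hc : 1 / 2 ≤ ⟪c, n⟫) (hw : ∀ k, ‖incr w' k - reg a b n c σ u v k‖ ≤ t) (ht : t < 1 / 2) :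
    IsStacked a b w' := by
  refine ⟨n, hn.2.1, hn.2.2, fun m => ?_⟩
  have h1 := inner_ge_of_near hn.1 (hw (m + 1))
  rw [inner_reg hn] at h1
  have h2 : incr w' (m + 1) = w' (m + 1) - w' m := by simp only [incr, add_sub_cancel_right]
  rw [h2] at h1
  linarith

/-- forward partial sums: `psumN h n = h 1 + ⋯ + h n`. -/
def psumN (h : ℤ → E3) : ℕ → E3
  | 0 => 0
  | n + 1 => psumN h n + h ((n : ℤ) + 1)

/-- backward partial sums: `nsumN h n = −(h 0 + h (−1) + ⋯ + h (1 − n))`. -/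
def nsumN (h : ℤ → E3) : ℕ → E3
  | 0 => 0
  | n + 1 => nsumN h n - h (-(n : ℤ))

/-- an offset profile with prescribed increments (`incr_psum`). -/
def psum (h : ℤ → E3) : ℤ → E3
  | Int.ofNat n => psumN h n
  | Int.negSucc n => nsumN h (n + 1)

/-- `incr (psum h) = h`: every increment profile is the increment profile of an offset profile. [folklore] -/
theorem incr_psum (h : ℤ → E3) : incr (psum h) = h := by
  funext m
  show psum h m - psum h (m - 1) = h m
  cases m with
  | ofNat n =>
    cases n with
    | zero =>
      rw [show (Int.ofNat 0 : ℤ) - 1 = Int.negSucc 0 from rfl]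
      simp [psum, psumN, nsumN]
    | succ k =>
      rw [show (Int.ofNat (k + 1) : ℤ) - 1 = Int.ofNat k from by simp]
      simp only [psum, psumN]
      rw [add_sub_cancel_left]
      rfl
  | negSucc n =>
    rw [show (Int.negSucc n : ℤ) - 1 = Int.negSucc (n + 1) from rfl]
    simp only [psum, nsumN]
    rw [sub_sub_cancel]
    rfl

/-- every increment profile comes from an offset profile. [folklore] -/
theorem exists_profile_of_incr (h : ℤ → E3) : ∃ w : ℤ → E3, incr w = h := ⟨psum h, incr_psum h⟩

/-! ## §4 Feeders (PROVED): the scalar data feed the two interfaces through the landed kernel -/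

/-- **Z∃ from R1 + R2.**  `RegistryResidual ε → RegistryTube r μ → RegistryZeroExists r″` whenever `4ε ≤ 3μr` (the kernel's smallness) and
`4ε ≤ 3μr″` (its localisation `4ε/(3(λ − ρd)) ≤ r″`). [this file, via `exists_zeroStress_of_tube_data`] -/
theorem zeroExists_of_residual_tube {s₁ s₂ ε r μ r'' : ℝ} (hε : 0 ≤ ε) (hμ : 0 < μ) (hr : 0 ≤ r) (hr'' : 0 ≤ r'')
    (hεr : 4 * ε ≤ 3 * μ * r) (hεr'' : 4 * ε ≤ 3 * μ * r'') (hRes : RegistryResidual s₁ s₂ ε) (hT : RegistryTube s₁ s₂ r μ) :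
    RegistryZeroExists s₁ s₂ r'' := by
  intro a b n c σ u v hp hn hb
  obtain ⟨lam, ρd, κ, hκ0, hκs, hρ, hμl, hmono, hlip⟩ := hT a b n c σ u v hp hn hb
  have hgap : μ ≤ lam - ρd := by linarith
  have hρl : ρd < lam := by linarith
  have h3 : (0 : ℝ) < 3 * (lam - ρd) := by linarith
  have hεr' : 4 * ε ≤ 3 * (lam - ρd) * r :=
    hεr.trans (by nlinarith [mul_nonneg (sub_nonneg.2 hgap) hr])
  obtain ⟨h, _hwin, hz, hclose⟩ :=
    exists_zeroStress_of_tube_data hε hκ0 hκs hρ hρl hmono hlip (hRes a b n c σ u v hp hn hb) hεr'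
  refine ⟨h, fun k => (hclose k).trans ?_, hz⟩
  rw [div_le_iff₀ h3]
  nlinarith [mul_nonneg (sub_nonneg.2 hgap) hr'']

/-- **Z! from R2.**  `RegistryTube r μ → RegistryZeroUnique r` (`μ > 0`). [this file, via `zero_unique_of_tube_data`] -/
theorem zeroUnique_of_tube {s₁ s₂ r μ : ℝ} (hμ : 0 < μ) (hT : RegistryTube s₁ s₂ r μ) : RegistryZeroUnique s₁ s₂ r := by
  intro a b n c σ u v hp hn hb h h' hh hh' hz hz'
  obtain ⟨lam, ρd, κ, hκ0, hκs, hρ, hμl, hmono, hlip⟩ := hT a b n c σ u v hp hn hb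
  exact zero_unique_of_tube_data (Φ := gapStress a b) hκ0 hκs (by linarith) hmono hlip
    (fun k => mem_closedBall.2 (by rw [dist_eq_norm]; exact hh k))
    (fun k => mem_closedBall.2 (by rw [dist_eq_norm]; exact hh' k)) hz hz'

/-! ## §5 The seams (PROVED) -/

/-- ★ **EIGHTEENTH seam.** `CellPinningW → RegistryLocalisationW r′ → RegistryZeroExists r″ → RegistryMetric r″ → BasalReferenceW Λ₁ ρ₁` for
`r″ < 1/2` and `r′ + r″ ≤ ρ₁`: the registry zero is the reference — stacked (heights `≥ 1/2 − r″ > 0`), within `r″ + r′ ≤ ρ₁` of the configuration's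
increments, zero gap stress, uniformly clean by the metric check. [this file] -/
theorem basalReferenceW_of_registry {Λ₁ s₁ s₂ r' r'' ρ₁ : ℝ} (hr'' : r'' < 1 / 2) (hρ₁ : r' + r'' ≤ ρ₁)
    (hPin : CellPinningW Λ₁ s₁ s₂) (hLoc : RegistryLocalisationW Λ₁ s₁ s₂ r') (hEx : RegistryZeroExists s₁ s₂ r'')
    (hMet : RegistryMetric s₁ s₂ r'') : BasalReferenceW Λ₁ ρ₁ := by
  intro δ hδ a b w hst hab ha hb hs hc hna hf hz
  have hp := hPin δ hδ a b w hst hab ha hb hs hc hna hf hz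
  obtain ⟨n, c, σ, u, v, hn, hbal, hloc⟩ := hLoc δ hδ a b w hst hab ha hb hs hc hna hf hz hp
  obtain ⟨h, hh, hz'⟩ := hEx a b n c σ u v hp hn hbal
  obtain ⟨w', hw'⟩ := exists_profile_of_incr h
  have hh' : ∀ k, ‖incr w' k - reg a b n c σ u v k‖ ≤ r'' := fun k => by rw [hw']; exact hh k
  refine ⟨w', isStacked_of_near_reg hn hbal.1 hh' hr'', fun m => ?_, fun m => by rw [hw']; exact hz' m,
    hMet a b n c σ u v hp hn hbal w' hh'⟩
  rw [tube, mem_closedBall, dist_eq_norm]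
  calc ‖incr w' m - incr w m‖ ≤ ‖incr w' m - reg a b n c σ u v m‖ + ‖incr w m - reg a b n c σ u v m‖ := by
        rw [← norm_neg (incr w m - reg a b n c σ u v m), neg_sub]
        exact norm_sub_le_norm_sub_add_norm_sub _ _ _
    _ ≤ r'' + r' := add_le_add (hh' m) (hloc m)
    _ ≤ ρ₁ := by linarith

/-- ★ **NINETEENTH seam.** `CellPinningW → RegistryLocalisationW r′ → RegistryZeroExists r″ → RegistryZeroUnique r → RegistryMetric r″ →
BasalGapRigidityW Λ₁` for `r″ ≤ r` and `r′ ≤ r`: when the configuration itself lies in the uniqueness windows round the registry, it IS the registry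
zero, hence within `r″` of the registry, hence uniformly clean — no annulus exclusion, no tube round the configuration. [this file] -/
theorem basalGapRigidityW_of_registry {Λ₁ s₁ s₂ r r' r'' : ℝ} (hr''r : r'' ≤ r) (hr'r : r' ≤ r)
    (hPin : CellPinningW Λ₁ s₁ s₂) (hLoc : RegistryLocalisationW Λ₁ s₁ s₂ r') (hEx : RegistryZeroExists s₁ s₂ r'')
    (hUq : RegistryZeroUnique s₁ s₂ r) (hMet : RegistryMetric s₁ s₂ r'') : BasalGapRigidityW Λ₁ := by
  intro δ hδ a b w hst hab ha hb hs hc hna hf hz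
  have hp := hPin δ hδ a b w hst hab ha hb hs hc hna hf hz
  obtain ⟨n, c, σ, u, v, hn, hbal, hloc⟩ := hLoc δ hδ a b w hst hab ha hb hs hc hna hf hz hp
  obtain ⟨h, hh, hz'⟩ := hEx a b n c σ u v hp hn hbal
  have heq : h = incr w :=
    hUq a b n c σ u v hp hn hbal h (incr w) (fun k => (hh k).trans hr''r) (fun k => (hloc k).trans hr'r) hz' hz
  exact hMet a b n c σ u v hp hn hbal w fun k => by rw [← heq]; exact hh k

/-! ## §6 The cones -/

/-- ★ **RDEF cone, EIGHTEENTH form** (every `Λ Λ₁ ρ₀ ρ₁ s₁ s₂ r′ r″` with `r″ < 1/2`, `r′ + r″ ≤ ρ₁`): the sixteenth-uniq cone of record with slot 7d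
`BasalReferenceW Λ₁ ρ₁` := R4 `CellPinningW Λ₁ s₁ s₂` ∧ R3 `RegistryLocalisationW Λ₁ s₁ s₂ r′` ∧ Z∃ `RegistryZeroExists s₁ s₂ r″` ∧ R5
`RegistryMetric s₁ s₂ r″`. [this file] -/
theorem rdef_of_grossU_shape_gluing_pinning_uniq_registry (Λ Λ₁ ρ₀ ρ₁ s₁ s₂ r' r'' : ℝ) (hr'' : r'' < 1 / 2) (hρ₁ : r' + r'' ≤ ρ₁)
    (hG : GrossCleanBallsU (1 / 250) 10) (hCEG : ChargedEnergyGap) (hC : CompressedVirialLaw (1 / 250) 10)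
    (hS : TwoShellShape (1 / 100) (3 / 50) (1 / 450)) (hB₂ : BarlowGluingW) (hD : DoorPeriodicW Λ) (hSR : StackedReductionW Λ Λ₁)
    (hV : GapStressVanishesW Λ₁) (hP : RegistryPinningW Λ₁ ρ₀ ρ₁) (hU : TubeUniquenessW Λ₁ ρ₀) (hPin : CellPinningW Λ₁ s₁ s₂)
    (hLoc : RegistryLocalisationW Λ₁ s₁ s₂ r') (hEx : RegistryZeroExists s₁ s₂ r'') (hMet : RegistryMetric s₁ s₂ r'')
    (hCE : CleanlessExcessT) (hRes : CoherentResidual 10) : RobustDefectLimitWindows :=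
  rdef_of_grossU_shape_gluing_pinning_uniqW Λ Λ₁ ρ₀ ρ₁ hG hCEG hC hS hB₂ hD hSR hV hP hU
    (basalReferenceW_of_registry hr'' hρ₁ hPin hLoc hEx hMet) hCE hRes

/-- **RDEF cone, eighteenth form, SCALAR-FED** (every `… ε r μ` with `0 ≤ ε`, `0 < μ`, `0 ≤ r`, `0 ≤ r″ < 1/2`, `4ε ≤ 3μr`, `4ε ≤ 3μr″`,
`r′ + r″ ≤ ρ₁`): Z∃ := R1 `RegistryResidual s₁ s₂ ε` ∧ R2 `RegistryTube s₁ s₂ r μ`.  Of record (provisional, census TAG 170):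
`(Λ, Λ₁; ρ₀, ρ₁; ε, r, μ; r′, r″) = (2, 17/16; 1/40, 3/16; 1/250, 1/100, 1; 7/40, 3/500)`, box `[s₁, s₂]` from the census. [this file] -/
theorem rdef_of_grossU_shape_gluing_pinning_uniq_registryScalar (Λ Λ₁ ρ₀ ρ₁ s₁ s₂ ε r μ r' r'' : ℝ) (hε : 0 ≤ ε) (hμ : 0 < μ)
    (hr : 0 ≤ r) (hr''0 : 0 ≤ r'') (hr'' : r'' < 1 / 2) (hεr : 4 * ε ≤ 3 * μ * r) (hεr'' : 4 * ε ≤ 3 * μ * r'') (hρ₁ : r' + r'' ≤ ρ₁)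
    (hG : GrossCleanBallsU (1 / 250) 10) (hCEG : ChargedEnergyGap) (hC : CompressedVirialLaw (1 / 250) 10)
    (hS : TwoShellShape (1 / 100) (3 / 50) (1 / 450)) (hB₂ : BarlowGluingW) (hD : DoorPeriodicW Λ) (hSR : StackedReductionW Λ Λ₁)
    (hV : GapStressVanishesW Λ₁) (hP : RegistryPinningW Λ₁ ρ₀ ρ₁) (hU : TubeUniquenessW Λ₁ ρ₀) (hPin : CellPinningW Λ₁ s₁ s₂)
    (hLoc : RegistryLocalisationW Λ₁ s₁ s₂ r') (hR1 : RegistryResidual s₁ s₂ ε) (hR2 : RegistryTube s₁ s₂ r μ)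
    (hMet : RegistryMetric s₁ s₂ r'') (hCE : CleanlessExcessT) (hRes : CoherentResidual 10) : RobustDefectLimitWindows :=
  rdef_of_grossU_shape_gluing_pinning_uniq_registry Λ Λ₁ ρ₀ ρ₁ s₁ s₂ r' r'' hr'' hρ₁ hG hCEG hC hS hB₂ hD hSR hV hP hU hPin hLoc
    (zeroExists_of_residual_tube hε hμ hr hr''0 hεr hεr'' hR1 hR2) hMet hCE hRes

/-- DEPRECATED v1 literals `(1/2000, 1/100, 3/20; 7/40, 1/200)` (append-only): `ε = 1/2000` is below the expected modulation and `μ = 3/20` is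
scalar-seam currency — superseded by `rdef_eighteenth_of_recordK`; still a theorem, its `RegistryResidual … (1/2000)` is just not expected. -/
theorem rdef_eighteenth_of_record (s₁ s₂ : ℝ) (hG : GrossCleanBallsU (1 / 250) 10) (hCEG : ChargedEnergyGap)
    (hC : CompressedVirialLaw (1 / 250) 10) (hS : TwoShellShape (1 / 100) (3 / 50) (1 / 450)) (hB₂ : BarlowGluingW) (hD : DoorPeriodicW 2)
    (hSR : StackedReductionW 2 (17 / 16)) (hV : GapStressVanishesW (17 / 16)) (hP : RegistryPinningW (17 / 16) (1 / 40) (3 / 16))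
    (hU : TubeUniquenessW (17 / 16) (1 / 40)) (hPin : CellPinningW (17 / 16) s₁ s₂) (hLoc : RegistryLocalisationW (17 / 16) s₁ s₂ (7 / 40))
    (hR1 : RegistryResidual s₁ s₂ (1 / 2000)) (hR2 : RegistryTube s₁ s₂ (1 / 100) (3 / 20)) (hMet : RegistryMetric s₁ s₂ (1 / 200))
    (hCE : CleanlessExcessT) (hRes : CoherentResidual 10) : RobustDefectLimitWindows :=
  rdef_of_grossU_shape_gluing_pinning_uniq_registryScalar 2 (17 / 16) (1 / 40) (3 / 16) s₁ s₂ (1 / 2000) (1 / 100) (3 / 20) (7 / 40) (1 / 200)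
    (by norm_num) (by norm_num) (by norm_num) (by norm_num) (by norm_num) (by norm_num) (by norm_num) (by norm_num)
    hG hCEG hC hS hB₂ hD hSR hV hP hU hPin hLoc hR1 hR2 hMet hCE hRes

/-- ★ the eighteenth cone AT THE NUMBERS OF RECORD, kernel currency `(ε, r, μ; r′, r″) = (1/250, 1/100, 1; 7/40, 3/500)` (`4ε = 0.016 ≤ 3μr″ =
0.018 ≤ 3μr`, `r′ + r″ ≤ 3/16`, … by `norm_num`; `s₁ s₂` symbolic until the census fixes the box). -/
theorem rdef_eighteenth_of_recordK (s₁ s₂ : ℝ) (hG : GrossCleanBallsU (1 / 250) 10) (hCEG : ChargedEnergyGap)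
    (hC : CompressedVirialLaw (1 / 250) 10) (hS : TwoShellShape (1 / 100) (3 / 50) (1 / 450)) (hB₂ : BarlowGluingW) (hD : DoorPeriodicW 2)
    (hSR : StackedReductionW 2 (17 / 16)) (hV : GapStressVanishesW (17 / 16)) (hP : RegistryPinningW (17 / 16) (1 / 40) (3 / 16))
    (hU : TubeUniquenessW (17 / 16) (1 / 40)) (hPin : CellPinningW (17 / 16) s₁ s₂) (hLoc : RegistryLocalisationW (17 / 16) s₁ s₂ (7 / 40))
    (hR1 : RegistryResidual s₁ s₂ (1 / 250)) (hR2 : RegistryTube s₁ s₂ (1 / 100) 1) (hMet : RegistryMetric s₁ s₂ (3 / 500))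
    (hCE : CleanlessExcessT) (hRes : CoherentResidual 10) : RobustDefectLimitWindows :=
  rdef_of_grossU_shape_gluing_pinning_uniq_registryScalar 2 (17 / 16) (1 / 40) (3 / 16) s₁ s₂ (1 / 250) (1 / 100) 1 (7 / 40) (3 / 500)
    (by norm_num) (by norm_num) (by norm_num) (by norm_num) (by norm_num) (by norm_num) (by norm_num) (by norm_num)
    hG hCEG hC hS hB₂ hD hSR hV hP hU hPin hLoc hR1 hR2 hMet hCE hRes

/-- ★ **RDEF cone, NINETEENTH form** (every `Λ Λ₁ s₁ s₂ r r′ r″` with `r″ ≤ r`, `r′ ≤ r`): the FIFTEENTH-stackedW cone with slot 7c+7c″+7d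
`BasalGapRigidityW Λ₁` := R4 ∧ R3 `r′` ∧ Z∃ `r″` ∧ Z! `r` ∧ R5 `r″` — no `TubeUniquenessW`, no `RegistryPinningW` (price: uniqueness windows round
the REGISTRY of radius `r ≥ r′`, i.e. fat tube data — convex typing). [this file] -/
theorem rdef_of_grossU_shape_gluing_registry (Λ Λ₁ s₁ s₂ r r' r'' : ℝ) (hr''r : r'' ≤ r) (hr'r : r' ≤ r)
    (hG : GrossCleanBallsU (1 / 250) 10) (hCEG : ChargedEnergyGap) (hC : CompressedVirialLaw (1 / 250) 10)
    (hS : TwoShellShape (1 / 100) (3 / 50) (1 / 450)) (hB₂ : BarlowGluingW) (hD : DoorPeriodicW Λ) (hSR : StackedReductionW Λ Λ₁)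
    (hV : GapStressVanishesW Λ₁) (hPin : CellPinningW Λ₁ s₁ s₂) (hLoc : RegistryLocalisationW Λ₁ s₁ s₂ r')
    (hEx : RegistryZeroExists s₁ s₂ r'') (hUq : RegistryZeroUnique s₁ s₂ r) (hMet : RegistryMetric s₁ s₂ r'')
    (hCE : CleanlessExcessT) (hRes : CoherentResidual 10) : RobustDefectLimitWindows :=
  rdef_of_grossU_shape_gluing_stackedW Λ Λ₁ hG hCEG hC hS hB₂ hD hSR hV
    (basalGapRigidityW_of_registry hr''r hr'r hPin hLoc hEx hUq hMet) hCE hRes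

/-- **RDEF cone, nineteenth form, SCALAR-FED** (`Z∃`, `Z!` := R1 ∧ R2 through the kernel; `r ≥ r′` makes this the FAT-window reading — listed for
the record, the scalar data are not expected to reach `r = r′ ≈ 7/40`). [this file] -/
theorem rdef_of_grossU_shape_gluing_registryScalar (Λ Λ₁ s₁ s₂ ε r μ r' r'' : ℝ) (hε : 0 ≤ ε) (hμ : 0 < μ) (hr : 0 ≤ r)
    (hr''0 : 0 ≤ r'') (hεr : 4 * ε ≤ 3 * μ * r) (hεr'' : 4 * ε ≤ 3 * μ * r'') (hr''r : r'' ≤ r) (hr'r : r' ≤ r)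
    (hG : GrossCleanBallsU (1 / 250) 10) (hCEG : ChargedEnergyGap) (hC : CompressedVirialLaw (1 / 250) 10)
    (hS : TwoShellShape (1 / 100) (3 / 50) (1 / 450)) (hB₂ : BarlowGluingW) (hD : DoorPeriodicW Λ) (hSR : StackedReductionW Λ Λ₁)
    (hV : GapStressVanishesW Λ₁) (hPin : CellPinningW Λ₁ s₁ s₂) (hLoc : RegistryLocalisationW Λ₁ s₁ s₂ r')
    (hR1 : RegistryResidual s₁ s₂ ε) (hR2 : RegistryTube s₁ s₂ r μ) (hMet : RegistryMetric s₁ s₂ r'')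
    (hCE : CleanlessExcessT) (hRes : CoherentResidual 10) : RobustDefectLimitWindows :=
  rdef_of_grossU_shape_gluing_registry Λ Λ₁ s₁ s₂ r r' r'' hr''r hr'r hG hCEG hC hS hB₂ hD hSR hV hPin hLoc
    (zeroExists_of_residual_tube hε hμ hr hr''0 hεr hεr'' hR1 hR2) (zeroUnique_of_tube hμ hR2) hMet hCE hRes

end Summit.AtomisticToContinuum.Crystallization.Theorems.OverbindingBudgetRegistryCut

end
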